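import Summits.ResolutionOfSingularities.ResolutionOfSingularities.Theorems.PurelyInseparableDim4ResConeKTwoFiveResiduals
import Summits.ResolutionOfSingularities.ResolutionOfSingularities.Theorems.PurelyInseparableDim4ResConeBInfKeepStep
import Summits.ResolutionOfSingularities.ResolutionOfSingularities.Theorems.PurelyInseparableDim4ResConeBInfLoseStep
import Summits.ResolutionOfSingularities.ResolutionOfSingularities.Theorems.PurelyInseparableDim4ResConeLightTail
import Summits.ResolutionOfSingularities.ResolutionOfSingularities.Theorems.PurelyInseparableDim4ResConeTailDFourFiveResidual
import Summits.ResolutionOfSingularities.ResolutionOfSingularities.Theorems.PurelyInseparableDim4E2OfCJSTrichotomyPrime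
import HarnessLib
import HarnessLib.Audit.Tags

/-!
# Purely inseparable four-folds — TAIL-B `(5,3)` IS CLOSED ‖ K, so K2(5) ⟸ TWO `(5,4)` RESIDUALS (in either dress: the re-presentation
# hypotheses hN4-C′ / hN4-D, or res-dim4-p-5's chain shapes «rotating B∞» / «three chart letters»), and F4-I(5,5) ⟸ CJS 6.40 + the same two
# (cell `res-dim4-pi`, K2(p) lane holder file, ledger theorem v8.3)

[OURS · counted 0 · cell `res-dim4-pi` · K2(p) lane holder res-dim4-p-12 g4.]  Nothing here proves K2(5) (`RidgeBudget.NoAboveFloorTrap 5 5`),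
F4-I (`NoIsolatedTrap 5 5`) or resolution of singularities in dimension ≥ 4 / characteristic `p` — NOT proved: the K2(5)/F4-I theorems below
are CONDITIONAL on two named OURS hypotheses about `(5,4)` binary-cone tails (and F4-I on the published CJS Key Theorem 6.40 as typed).
AI kernel work, weaker than expert review.

Since ledger v8 (p704409) all three `(5,3)` inputs have become tree theorems: the Φ-KEEP law `ResCone.stub_keep` (res-dim4-p-7 g4,
`…BInfKeepStep`), the Φ-LOSE law `ResCone.bInf_stub_lose` (res-dim4-p-2 g5, `…BInfLoseStep`) — both over res-dim4-p-11 g4's (K-Φ2) dictionary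
and res-dim4-idea-1's CARD I-1-8 — and hN4-C `ResCone.LightRep.light_lossfree_representation` (res-dim4-p-1 g5, `…LightTail`: every light
`(5,3)` tail has a loss-free VIRTUAL re-presentation, via res-dim4-typ-1's window machinery).  Hence:
* **`no_binaryCone_tail_three_five`** — TAIL-B: over a field of characteristic `5` no witnessed all-isolated above-floor `Step0 5` chain with
  `x^{r₀} ∣ F₀` has constant shade `3` and `e_G = 2` from some index on (res-dim4-p-9 g4's `tailB_three_five_of_KL_of_light`, p703425, fed with
  the three tree theorems); so **the d = 3 half of slice C at p = 5 is EMPTY ‖ K**;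
* **`noAboveFloorTrap_five_iff_tailD`** — K2(5) ⟺ TAIL-D (shade `4`, `e_G = 2`) alone;
* **`noAboveFloorTrap_five_of_pair_representations (hN4C') (hN4D)`** — K2(5) from the two `(5,4)` re-presentation hypotheses of
  `…RepresentationSockets` (p703603);
* **`noAboveFloorTrap_five_of_rotations (hRot) (hThree)`** — K2(5) from res-dim4-p-5 g4's two located chain shapes (`…TailDFourFiveResidual`
  p705797: hRot «rotating B∞»: a light pair tail alternating between chart letters `a, a′`, a third letter `i` never translated with
  `r_{k+1} = e_{j k} + e_i`; hThree: three letters each charted beyond every index);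
* **`noIsolatedTrap_five_of_pair_representations` / `noIsolatedTrap_five_of_rotations`** — F4-I(5,5) from CJS 6.40 + the same two
  (`E2OfCJS.noIsolatedTrap_of_KeyTheorem640_of_noAboveFloorTrap`).

[cite: CossartJannsenSaito2020, Thm. 3.14, Thm. 6.40, Lemma 13.4, Thm. 13.7] [cite: HauserPerlega2019PRIMS, §2 (transform D′ of D)]
bears_on: LADDER-RESOLUTION:D157-DOOR2 (res-dim4-pi · K2(p) · ledger theorem v8.3).  Supports stmt-ResolutionOfSingularities-16155 (helper).
-/

set_option linter.dupNamespace false -- mandated namespace of this single-conjunct summit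

noncomputable section

namespace Summit.ResolutionOfSingularities.ResolutionOfSingularities.Theorems.PIDim4

namespace ResCone

open MvPolynomial Finset
open Literature.AlgebraicGeometry.Resolution
open Literature.AlgebraicGeometry.Resolution.CentreBlowup
open Literature.AlgebraicGeometry.Resolution.Hauser2010
open Literature.AlgebraicGeometry.Resolution.HauserPerlega2019
open Literature.AlgebraicGeometry.Resolution.WeightedOrder
open RidgeBudget (NoAboveFloorTrap)
open Literature.AlgebraicGeometry.CossartJannsenSaito2020 (KeyTheorem640_char_localized_isolated)

variable {K : Type} [Field K] [CharP K 5] [DecidableEq K]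

/-- **TAIL-B `(5,3)` IS EMPTY ‖ K**: over a field of characteristic `5` there is no witnessed all-isolated above-floor `Step0 5` chain with
`x^{r₀} ∣ F₀` whose shade is `3` and whose `e_G` is `2` from some `k₀` on.  Composition of res-dim4-p-9 g4's `tailB_three_five_of_KL_of_light`
with the three tree theorems `LightRep.no_light_tail_three_five` (light branch), `stub_keep` (KEEP law), `bInf_stub_lose` (LOSE law). [OURS]
[cite: CossartJannsenSaito2020, Thm. 3.14, Lemma 13.4, Thm. 13.7] -/
theorem no_binaryCone_tail_three_five (c : ℕ → State K) (j : ℕ → Fin 4) (b : ℕ → Fin 4 → K)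
    (hc : ∀ k, IsIsolated 5 (c k).F ∧ Step0 5 (c k) (c (k + 1))) (hw : FreeTail.IsWitnessedChain 5 c j b)
    (hr0 : ∀ e ∈ (c 0).F.support, (c 0).r ≤ e) (hfloor : ∀ k, ordZero (c k).F ≠ (5 : ℕ)) (k₀ : ℕ)
    (hshade : ∀ k, k₀ ≤ k → (c k).shade = ((3 : ℕ) : ℕ∞))
    (he : ∀ k, k₀ ≤ k → Module.finrank K (resVertex (c k)) = 2) : False :=
  tailB_three_five_of_KL_of_light hc hw hr0 hfloor hshade he
    (fun hlt => LightRep.no_light_tail_three_five c j b hc hw hr0 hfloor k₀ hshade he hlt)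
    (fun k hk h3 h L M hinv => stub_keep hc hw hr0 (fun k => by exact_mod_cast hfloor k) hshade he hk h3 hinv)
    (bInf_stub_lose hc hw hr0 (fun k => by exact_mod_cast hfloor k) hshade he)

omit [CharP K 5] [DecidableEq K] in
/-- **K2(5) ⟺ TAIL-D ALONE** (TAIL-B being empty): `RidgeBudget.NoAboveFloorTrap 5 5` holds iff over every field of characteristic `5` no
witnessed all-isolated above-floor `Step0 5` chain with `x^{r₀} ∣ F₀` has constant shade `4` and `e_G = 2` from some index on. [OURS]
[cite: CossartJannsenSaito2020, Thm. 3.14] -/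
theorem noAboveFloorTrap_five_iff_tailD :
    NoAboveFloorTrap 5 5 ↔ ∀ (K : Type) [Field K] [CharP K 5] [DecidableEq K],
      ∀ (c : ℕ → State K) (j : ℕ → Fin 4) (b : ℕ → Fin 4 → K),
        (∀ k, IsIsolated 5 (c k).F ∧ Step0 5 (c k) (c (k + 1))) → FreeTail.IsWitnessedChain 5 c j b →
        (∀ e ∈ (c 0).F.support, (c 0).r ≤ e) → (∀ k, ordZero (c k).F ≠ (5 : ℕ)) →
        ∀ k₀ : ℕ, (∀ k, k₀ ≤ k → (c k).shade = ((4 : ℕ) : ℕ∞)) →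
        (∀ k, k₀ ≤ k → Module.finrank K (resVertex (c k)) = 2) → False :=
  noAboveFloorTrap_five_iff_tails.trans
    ⟨fun h K _ _ _ => (h K).2, fun h K _ _ _ => ⟨no_binaryCone_tail_three_five, h K⟩⟩

omit [CharP K 5] [DecidableEq K] in
/-- **K2(5) FROM THE TWO `(5,4)` RE-PRESENTATION HYPOTHESES** hN4-C′ (light pair) and hN4-D (D∞ pair-confinement), binders verbatim from
`…RepresentationSockets`. [OURS · conditional on two named hypotheses] [cite: CossartJannsenSaito2020, Thm. 3.14] -/
theorem noAboveFloorTrap_five_of_pair_representations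
    (hN4C' : ∀ (K : Type) [Field K] [CharP K 5] [DecidableEq K], 
      ∀ (c : ℕ → State K) (j : ℕ → Fin 4) (b : ℕ → Fin 4 → K),
      (∀ k, IsIsolated 5 (c k).F ∧ Step0 5 (c k) (c (k + 1))) → FreeTail.IsWitnessedChain 5 c j b →
      (∀ e ∈ (c 0).F.support, (c 0).r ≤ e) → (∀ k, ordZero (c k).F ≠ (5 : ℕ)) →
      ∀ k₀ : ℕ, (∀ k, k₀ ≤ k → (c k).shade = ((4 : ℕ) : ℕ∞)) →
      (∀ k, k₀ ≤ k → Module.finrank K (resVertex (c k)) = 2) →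
      (∀ k, k₀ ≤ k → (∀ i, (c k).r i ≤ 1) ∧ (c k).r.degree = 2) →
      ∃ (c' : ℕ → State K) (j' : ℕ → Fin 4) (b' : ℕ → Fin 4 → K) (k₀' : ℕ),
        (∀ k, IsIsolated 5 (c' k).F ∧ Step0 5 (c' k) (c' (k + 1))) ∧ FreeTail.IsWitnessedChain 5 c' j' b' ∧
        (∀ e ∈ (c' 0).F.support, (c' 0).r ≤ e) ∧ (∀ k, ordZero (c' k).F ≠ (5 : ℕ)) ∧
        (∀ k, k₀' ≤ k → (c' k).shade = ((4 : ℕ) : ℕ∞)) ∧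
        (∀ k, k₀' ≤ k → Module.finrank K (resVertex (c' k)) = 2) ∧
        (∀ k, k₀' ≤ k → ∀ i, b' k i ≠ 0 → (c' k).r i = 0))
    (hN4D : ∀ (K : Type) [Field K] [CharP K 5] [DecidableEq K], 
      ∀ (c : ℕ → State K) (j : ℕ → Fin 4) (b : ℕ → Fin 4 → K),
      (∀ k, IsIsolated 5 (c k).F ∧ Step0 5 (c k) (c (k + 1))) → FreeTail.IsWitnessedChain 5 c j b →
      (∀ e ∈ (c 0).F.support, (c 0).r ≤ e) → (∀ k, ordZero (c k).F ≠ (5 : ℕ)) →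
      ∀ k₀ : ℕ, (∀ k, k₀ ≤ k → (c k).shade = ((4 : ℕ) : ℕ∞)) →
      (∀ k, k₀ ≤ k → Module.finrank K (resVertex (c k)) = 2) →
      ∀ k₁ : ℕ, k₀ ≤ k₁ → (∀ k, k₁ ≤ k → (∃ W, (c k).r W = 2 ∧ ∀ i, i ≠ W → (c k).r i ≤ 1) ∧
        (2 ≤ (c k).r.degree ∧ (c k).r.degree ≤ 3)) →
      ∃ (c' : ℕ → State K) (j' : ℕ → Fin 4) (b' : ℕ → Fin 4 → K) (k₀' : ℕ) (a a' : Fin 4),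
        (∀ k, IsIsolated 5 (c' k).F ∧ Step0 5 (c' k) (c' (k + 1))) ∧ FreeTail.IsWitnessedChain 5 c' j' b' ∧
        (∀ e ∈ (c' 0).F.support, (c' 0).r ≤ e) ∧ (∀ k, ordZero (c' k).F ≠ (5 : ℕ)) ∧
        (∀ k, k₀' ≤ k → (c' k).shade = ((4 : ℕ) : ℕ∞)) ∧
        (∀ k, k₀' ≤ k → Module.finrank K (resVertex (c' k)) = 2) ∧ a ≠ a' ∧
        (∀ k, k₀' ≤ k → (j' k = a ∨ j' k = a')) ∧
        (∀ k, k₀' ≤ k → ∀ i, i ≠ a → i ≠ a' → (c' k).r i = 0)) :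
    NoAboveFloorTrap 5 5 :=
  noAboveFloorTrap_five_of_residuals (fun K _ _ _ => LightRep.light_lossfree_representation)
    (fun K _ _ _ c j b hc hw hr0 hfloor k₀ hshade he k hk h3 h L M hinv =>
      stub_keep hc hw hr0 (fun k => by exact_mod_cast hfloor k) hshade he hk h3 hinv)
    (fun K _ _ _ c j b hc hw hr0 hfloor k₀ hshade he =>
      bInf_stub_lose hc hw hr0 (fun k => by exact_mod_cast hfloor k) hshade he)
    hN4C' hN4D

omit [CharP K 5] [DecidableEq K] in
/-- **K2(5) FROM res-dim4-p-5's TWO LOCATED `(5,4)` CHAIN SHAPES**: hRot («rotating B∞») and hThree («three chart letters»), binders verbatim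
from `tailD_four_five_of_residuals'` (p705797). [OURS · conditional on two named hypotheses] [cite: CossartJannsenSaito2020, Thm. 3.14] -/
theorem noAboveFloorTrap_five_of_rotations
    (hRot : ∀ (K : Type) [Field K] [CharP K 5] [DecidableEq K], 
      ∀ (c : ℕ → State K) (j : ℕ → Fin 4) (b : ℕ → Fin 4 → K),
      (∀ k, IsIsolated 5 (c k).F ∧ Step0 5 (c k) (c (k + 1))) → FreeTail.IsWitnessedChain 5 c j b →
      (∀ e ∈ (c 0).F.support, (c 0).r ≤ e) → (∀ k, ordZero (c k).F ≠ (5 : ℕ)) →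
      ∀ k₀ : ℕ, (∀ k, k₀ ≤ k → (c k).shade = ((4 : ℕ) : ℕ∞)) →
      (∀ k, k₀ ≤ k → Module.finrank K (resVertex (c k)) = 2) →
      ∀ a a' i : Fin 4, a ≠ a' → i ≠ a → i ≠ a' → (∀ k, k₀ ≤ k → (j k = a ∨ j k = a')) →
      (∀ N, ∃ k, N ≤ k ∧ j k = a) → (∀ N, ∃ k, N ≤ k ∧ j k = a') →
      (∀ k, k₀ ≤ k → b k i = 0 ∧ (c (k + 1)).r = Finsupp.single (j k) 1 + Finsupp.single i 1) → False)
    (hThree : ∀ (K : Type) [Field K] [CharP K 5] [DecidableEq K], 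
      ∀ (c : ℕ → State K) (j : ℕ → Fin 4) (b : ℕ → Fin 4 → K),
      (∀ k, IsIsolated 5 (c k).F ∧ Step0 5 (c k) (c (k + 1))) → FreeTail.IsWitnessedChain 5 c j b →
      (∀ e ∈ (c 0).F.support, (c 0).r ≤ e) → (∀ k, ordZero (c k).F ≠ (5 : ℕ)) →
      ∀ k₀ : ℕ, (∀ k, k₀ ≤ k → (c k).shade = ((4 : ℕ) : ℕ∞)) →
      (∀ k, k₀ ≤ k → Module.finrank K (resVertex (c k)) = 2) →
      ∀ x y z : Fin 4, x ≠ y → y ≠ z → x ≠ z →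
      (∀ N, ∃ k, N ≤ k ∧ j k = x) → (∀ N, ∃ k, N ≤ k ∧ j k = y) → (∀ N, ∃ k, N ≤ k ∧ j k = z) → False) :
    NoAboveFloorTrap 5 5 :=
  noAboveFloorTrap_five_iff_tailD.mpr fun K _ _ _ c j b hc hw hr0 hfloor k₀ hshade he =>
    tailD_four_five_of_residuals' (hRot K) (hThree K) c j b hc hw hr0 hfloor k₀ hshade he

omit [CharP K 5] [DecidableEq K] in
/-- **F4-I(5,5) FROM CJS 6.40 AND THE TWO `(5,4)` RE-PRESENTATION HYPOTHESES.** [OURS · conditional on a NAMED PUBLISHED FACT and two named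
OURS hypotheses] [cite: CossartJannsenSaito2020, Thm. 6.40, Thm. 3.14] -/
theorem noIsolatedTrap_five_of_pair_representations (hK640 : KeyTheorem640_char_localized_isolated.{0})
    (hN4C' : ∀ (K : Type) [Field K] [CharP K 5] [DecidableEq K], 
      ∀ (c : ℕ → State K) (j : ℕ → Fin 4) (b : ℕ → Fin 4 → K),
      (∀ k, IsIsolated 5 (c k).F ∧ Step0 5 (c k) (c (k + 1))) → FreeTail.IsWitnessedChain 5 c j b →
      (∀ e ∈ (c 0).F.support, (c 0).r ≤ e) → (∀ k, ordZero (c k).F ≠ (5 : ℕ)) →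
      ∀ k₀ : ℕ, (∀ k, k₀ ≤ k → (c k).shade = ((4 : ℕ) : ℕ∞)) →
      (∀ k, k₀ ≤ k → Module.finrank K (resVertex (c k)) = 2) →
      (∀ k, k₀ ≤ k → (∀ i, (c k).r i ≤ 1) ∧ (c k).r.degree = 2) →
      ∃ (c' : ℕ → State K) (j' : ℕ → Fin 4) (b' : ℕ → Fin 4 → K) (k₀' : ℕ),
        (∀ k, IsIsolated 5 (c' k).F ∧ Step0 5 (c' k) (c' (k + 1))) ∧ FreeTail.IsWitnessedChain 5 c' j' b' ∧
        (∀ e ∈ (c' 0).F.support, (c' 0).r ≤ e) ∧ (∀ k, ordZero (c' k).F ≠ (5 : ℕ)) ∧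
        (∀ k, k₀' ≤ k → (c' k).shade = ((4 : ℕ) : ℕ∞)) ∧
        (∀ k, k₀' ≤ k → Module.finrank K (resVertex (c' k)) = 2) ∧
        (∀ k, k₀' ≤ k → ∀ i, b' k i ≠ 0 → (c' k).r i = 0))
    (hN4D : ∀ (K : Type) [Field K] [CharP K 5] [DecidableEq K], 
      ∀ (c : ℕ → State K) (j : ℕ → Fin 4) (b : ℕ → Fin 4 → K),
      (∀ k, IsIsolated 5 (c k).F ∧ Step0 5 (c k) (c (k + 1))) → FreeTail.IsWitnessedChain 5 c j b →
      (∀ e ∈ (c 0).F.support, (c 0).r ≤ e) → (∀ k, ordZero (c k).F ≠ (5 : ℕ)) →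
      ∀ k₀ : ℕ, (∀ k, k₀ ≤ k → (c k).shade = ((4 : ℕ) : ℕ∞)) →
      (∀ k, k₀ ≤ k → Module.finrank K (resVertex (c k)) = 2) →
      ∀ k₁ : ℕ, k₀ ≤ k₁ → (∀ k, k₁ ≤ k → (∃ W, (c k).r W = 2 ∧ ∀ i, i ≠ W → (c k).r i ≤ 1) ∧
        (2 ≤ (c k).r.degree ∧ (c k).r.degree ≤ 3)) →
      ∃ (c' : ℕ → State K) (j' : ℕ → Fin 4) (b' : ℕ → Fin 4 → K) (k₀' : ℕ) (a a' : Fin 4),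
        (∀ k, IsIsolated 5 (c' k).F ∧ Step0 5 (c' k) (c' (k + 1))) ∧ FreeTail.IsWitnessedChain 5 c' j' b' ∧
        (∀ e ∈ (c' 0).F.support, (c' 0).r ≤ e) ∧ (∀ k, ordZero (c' k).F ≠ (5 : ℕ)) ∧
        (∀ k, k₀' ≤ k → (c' k).shade = ((4 : ℕ) : ℕ∞)) ∧
        (∀ k, k₀' ≤ k → Module.finrank K (resVertex (c' k)) = 2) ∧ a ≠ a' ∧
        (∀ k, k₀' ≤ k → (j' k = a ∨ j' k = a')) ∧
        (∀ k, k₀' ≤ k → ∀ i, i ≠ a → i ≠ a' → (c' k).r i = 0)) :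
    NoIsolatedTrap 5 5 :=
  haveI : Fact (Nat.Prime 5) := ⟨by norm_num⟩
  E2OfCJS.noIsolatedTrap_of_KeyTheorem640_of_noAboveFloorTrap 5 (by norm_num) hK640
    (noAboveFloorTrap_five_of_pair_representations hN4C' hN4D)

omit [CharP K 5] [DecidableEq K] in
/-- **F4-I(5,5) FROM CJS 6.40 AND res-dim4-p-5's TWO LOCATED CHAIN SHAPES.** [OURS · conditional on a NAMED PUBLISHED FACT and two named OURS
hypotheses] [cite: CossartJannsenSaito2020, Thm. 6.40, Thm. 3.14] -/
theorem noIsolatedTrap_five_of_rotations (hK640 : KeyTheorem640_char_localized_isolated.{0})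
    (hRot : ∀ (K : Type) [Field K] [CharP K 5] [DecidableEq K], 
      ∀ (c : ℕ → State K) (j : ℕ → Fin 4) (b : ℕ → Fin 4 → K),
      (∀ k, IsIsolated 5 (c k).F ∧ Step0 5 (c k) (c (k + 1))) → FreeTail.IsWitnessedChain 5 c j b →
      (∀ e ∈ (c 0).F.support, (c 0).r ≤ e) → (∀ k, ordZero (c k).F ≠ (5 : ℕ)) →
      ∀ k₀ : ℕ, (∀ k, k₀ ≤ k → (c k).shade = ((4 : ℕ) : ℕ∞)) →
      (∀ k, k₀ ≤ k → Module.finrank K (resVertex (c k)) = 2) →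
      ∀ a a' i : Fin 4, a ≠ a' → i ≠ a → i ≠ a' → (∀ k, k₀ ≤ k → (j k = a ∨ j k = a')) →
      (∀ N, ∃ k, N ≤ k ∧ j k = a) → (∀ N, ∃ k, N ≤ k ∧ j k = a') →
      (∀ k, k₀ ≤ k → b k i = 0 ∧ (c (k + 1)).r = Finsupp.single (j k) 1 + Finsupp.single i 1) → False)
    (hThree : ∀ (K : Type) [Field K] [CharP K 5] [DecidableEq K], 
      ∀ (c : ℕ → State K) (j : ℕ → Fin 4) (b : ℕ → Fin 4 → K),
      (∀ k, IsIsolated 5 (c k).F ∧ Step0 5 (c k) (c (k + 1))) → FreeTail.IsWitnessedChain 5 c j b →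
      (∀ e ∈ (c 0).F.support, (c 0).r ≤ e) → (∀ k, ordZero (c k).F ≠ (5 : ℕ)) →
      ∀ k₀ : ℕ, (∀ k, k₀ ≤ k → (c k).shade = ((4 : ℕ) : ℕ∞)) →
      (∀ k, k₀ ≤ k → Module.finrank K (resVertex (c k)) = 2) →
      ∀ x y z : Fin 4, x ≠ y → y ≠ z → x ≠ z →
      (∀ N, ∃ k, N ≤ k ∧ j k = x) → (∀ N, ∃ k, N ≤ k ∧ j k = y) → (∀ N, ∃ k, N ≤ k ∧ j k = z) → False) :
    NoIsolatedTrap 5 5 :=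
  haveI : Fact (Nat.Prime 5) := ⟨by norm_num⟩
  E2OfCJS.noIsolatedTrap_of_KeyTheorem640_of_noAboveFloorTrap 5 (by norm_num) hK640
    (noAboveFloorTrap_five_of_rotations hRot hThree)

end ResCone

end Summit.ResolutionOfSingularities.ResolutionOfSingularities.Theorems.PIDim4

end
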